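import Summits.BirchSwinnertonDyer.BirchSwinnertonDyer.Theses.PrintCf2
import Summits.BirchSwinnertonDyer.BirchSwinnertonDyer.Theorems.AdditiveRankOneBSDpRowKernels
import Summits.BirchSwinnertonDyer.Rank1Residual.Partition.CornersCM
import Literature.NumberTheory.EllipticCurves.HeegnerPointsKolyvaginExceptionalTwistProofs
import Literature.NumberTheory.EllipticCurves.BSDSelmerCMPConverseGoldfeldProofs
import Literature.NumberTheory.EllipticCurves.AnalyticRankOrderProofs
import Literature.NumberTheory.EllipticCurves.LFunctionSmulProofs
import HarnessLib

set_option linter.dupNamespace false -- `…BirchSwinnertonDyer.BirchSwinnertonDyer…` is the cell's namespace (D-0017)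
set_option autoImplicit false

/-!
# Crux `PrintCf2.SplitBadTwoRankOneOfFacts` (item 20368) — line `eisenstein_two_bdp_line`: the COMPOSITION in the tree
# («the six registered stubs ⟹ the crux», kernel-checked, sorry-free) and the `…OfFactsPlus` closer shape (K7t)

Lead `bsd-line-cf2-p1` g5 (prover), cell `bsd-print-cf2`, 2026-08-28. Line of record of crux 20368 since the lead's registration
d31d09cefdf06587 (critic idea-crit-10 VERDICT #19 PASS-WITH-PRICE on bsd-idea-7 g3's `Lines/eisenstein_two_bdp_line.lean`, plus the
lead's torsion repair): six `sorry`'d stubs live in the Cruxes workfile; THIS file carries no `sorry` — it proves, with the six stub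
STATEMENTS as displayed hypotheses, that they give the crux `PrintCf2.SplitBadTwoRankOneOfFacts` BY NAME, and it states the K7t
`…OfFactsPlus` twin shape («𝔅_split ∧ the six statements ⟹ the class statement») with its one-line proof, so a planner can book the
line's declared research content as an aside that closes by name. HONEST FRAMING: CONDITIONAL on every displayed hypothesis; the
research stubs (Λ-torsion, Eisenstein inclusion, Greenberg–Vatsal upgrade of the (∅,0) anticyclotomic main conjecture at `2`; the
integral BDP frame at `2`; the descent at `2`) are OPEN and unprinted at `p = 2`; nothing is closed; BSD is not proved by any of this.

* `rankZeroTwistBSDp_two_of_hasCM_of_print` — the rank-zero twist socket at `2` from Burungale–Flach (a conjunct of 𝔅_split) and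
  modularity: CM twist of analytic rank `0` ⟹ `BSD₂` (tree theorem `bsdp_cm_rankZero`).
* `splitBadTwoRankOneOfFacts_of_eisensteinTwoBdp` — stubs 0 (prints), 1 (frame), T (torsion), 2 (Eisenstein inclusion), 3 (upgrade),
  4 (descent) ⟹ the crux: `le_antisymm` of 2 and 3 under T, fed with 1 and the twist socket to 4.
* `splitBadEisensteinTwoBdpOfFactsPlus_of_print` — the aside shape, closed by the previous theorem.

References: Castella–Grossi–Lee–Skinner, Invent. Math. 227 (2022) Thm. 3.2.1 / 5.1.1 (p odd; shapes); Jetchev–Skinner–Wan, Camb. J.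
Math. 5 (2017) §7.4.1, Thm. 3.3.1; Liu–Zhang–Zhang, Duke Math. J. 167 (2018) Thm 1.5.1/1.5.3; Burungale–Flach, Camb. J. Math. 12 (2024)
Cor. 2; Kriz–Li, Forum Math. Sigma 7 (2019) §3; Keller–Yin, arXiv:2410.23241 (2024) (p ≥ 3 blueprint).
-/

noncomputable section

open scoped Classical

namespace Summit.BirchSwinnertonDyer.BirchSwinnertonDyer.Theorems.PrintCf2


open WeierstrassCurve NumberField IsDedekindDomain Field PowerSeries
  Literature.NumberTheory.EllipticCurves
  Literature.NumberTheory.EllipticCurves.ModularForms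
  Literature.NumberTheory.EllipticCurves.Rank1Residual
  Literature.NumberTheory.EllipticCurves.Rank1Residual.Typed
  Literature.NumberTheory.GaloisRepresentations
  Literature.NumberTheory.GaloisCohomology
  Summit.BirchSwinnertonDyer.Rank1Residual
  Summit.BirchSwinnertonDyer.Rank1Residual.Additive
  Summit.BirchSwinnertonDyer.Rank1Residual.X11b
  Summit.BirchSwinnertonDyer.Rank1Residual.X11b.AcSelmer
  Summit.BirchSwinnertonDyer.Rank1Residual.X11b.Halves
  Summit.BirchSwinnertonDyer.Rank1Residual.X11b.CongruenceLimit
  Summit.BirchSwinnertonDyer.BirchSwinnertonDyer.Theses.UniversalToricDescent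
  Summit.BirchSwinnertonDyer.BirchSwinnertonDyer.Theorems
  Summit.BirchSwinnertonDyer.BirchSwinnertonDyer.Theorems.SchneiderFree
  Summit.BirchSwinnertonDyer.BirchSwinnertonDyer.Theorems.SchneiderFreeControlAtoms
  Summit.BirchSwinnertonDyer.BirchSwinnertonDyer.Theorems.SchneiderFreeAdditiveX3
  Summit.BirchSwinnertonDyer.BirchSwinnertonDyer.Theorems.UniversalToricDescentWaldspurgerFlat


/-- **The rank-zero twist socket at `2`** (Burungale–Flach 2024 Cor. 2 via the partition theorem `bsdp_cm_rankZero`, + modularity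
for `L(W^{(d_K)},1) ≠ 0 ⟹ r_an = 0`): for a CM curve `W`, every globally minimal model `Wd` of the quadratic twist by the discriminant
of a Heegner field with non-vanishing central value has `BSD₂`. [cite: BurungaleFlach2024, Thm. 1.1 and Cor. 2] -/
theorem rankZeroTwistBSDp_two_of_hasCM_of_print (hBF : bsdTriple_of_hasCM_of_L_one_ne_zero) (hmod : hasEntireLFunction_rat)
    (W : WeierstrassCurve ℚ) [W.IsElliptic] (hCM : W.HasCM) :
    ∀ (N : ℕ) [NeZero N] (K : Type) [Field K] [NumberField K]
      (Wd : WeierstrassCurve ℚ) [Wd.IsElliptic] [Wd.IsGloballyMinimal],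
      W.conductorNorm ℤ = N → IsImaginaryQuadratic K → SatisfiesHeegnerHypothesis N K →
      (∃ C : VariableChange ℚ, C • W.quadraticTwist (NumberField.discr K : ℚ) = Wd) →
      (W.quadraticTwist (NumberField.discr K : ℚ)).entireLFunction 1 ≠ 0 → BSDp Wd 2 := by
  intro N _ K _ _ Wd _ _ _hN _hK _hHe hC hLt
  obtain ⟨C, rfl⟩ := hC
  have hd : (NumberField.discr K : ℚ) ≠ 0 := by exact_mod_cast NumberField.discr_ne_zero K
  haveI hEd : (W.quadraticTwist (NumberField.discr K : ℚ)).IsElliptic := W.isElliptic_quadraticTwist hd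
  have hCMd : (W.quadraticTwist (NumberField.discr K : ℚ)).HasCM := hasCM_quadraticTwist_of_hasCM W hCM hd
  have hCM' : (C • W.quadraticTwist (NumberField.discr K : ℚ)).HasCM :=
    hasCM_variableChange (W.quadraticTwist (NumberField.discr K : ℚ)) C hCMd
  have hr0d : (W.quadraticTwist (NumberField.discr K : ℚ)).analyticRank = 0 :=
    (analyticRank_eq_zero_iff_holds (hmod _)).mpr hLt
  have hr0 : (C • W.quadraticTwist (NumberField.discr K : ℚ)).analyticRank = 0 := by
    rw [WeierstrassCurve.analyticRank_smul]; exact hr0d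
  exact bsdp_cm_rankZero hBF hmod hCM' hr0


/-- **COMPOSITION: the six registered stubs of line `eisenstein_two_bdp_line` give the crux BY NAME** (kernel-checked; the stub
statements are the displayed hypotheses `h0` prints, `h1` integral BDP frame at `2`, `hT` Λ-torsion of `X_(∅,0)` at `2`, `h2` Eisenstein
inclusion, `h3` Greenberg–Vatsal upgrade, `h4` descent at `2`). CONDITIONAL; closes nothing.
[cite: JetchevSkinnerWan2017, §7.4.1 and Thm. 3.3.1 (arXiv:1512.06894 pp. 11, 30) (odd-p blueprint)] -/
theorem splitBadTwoRankOneOfFacts_of_eisensteinTwoBdp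
    (h0 : (ToricPublishedInputs ∧
      LiuZhangZhang2018.thm151_thm153_modularCurve_heegnerVector_additive ∧
      bsdTriple_of_hasCM_of_L_one_ne_zero ∧
      (∀ (K : Type) [Field K] [NumberField K], poitouTate_selmerStructure_duality K) ∧
      (∀ (K : Type) [Field K] [NumberField K], poitouTate_sha_tateDual K) ∧
      (∀ (K : Type) [Field K] [NumberField K] (v : HeightOneSpectrum (𝓞 K)),
        localEulerPoincareCharacteristic (v.adicCompletion K)) ∧
      fieldCdLE_two_of_numberField ∧
      (∀ (K : Type) [Field K] [NumberField K] (p : ℕ) [Fact p.Prime],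
        ZpExtension.decomp_not_le_kerSubgroup_of_isAnticyclotomic K p)))
    (h1 : (ToricPublishedInputs ∧
      LiuZhangZhang2018.thm151_thm153_modularCurve_heegnerVector_additive ∧
      bsdTriple_of_hasCM_of_L_one_ne_zero ∧
      (∀ (K : Type) [Field K] [NumberField K], poitouTate_selmerStructure_duality K) ∧
      (∀ (K : Type) [Field K] [NumberField K], poitouTate_sha_tateDual K) ∧
      (∀ (K : Type) [Field K] [NumberField K] (v : HeightOneSpectrum (𝓞 K)),
        localEulerPoincareCharacteristic (v.adicCompletion K)) ∧
      fieldCdLE_two_of_numberField ∧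
      (∀ (K : Type) [Field K] [NumberField K] (p : ℕ) [Fact p.Prime],
        ZpExtension.decomp_not_le_kerSubgroup_of_isAnticyclotomic K p)) →
      ∀ (W : WeierstrassCurve ℚ) [W.IsElliptic] [W.IsGloballyMinimal],
      W.HasCM → W.analyticRank = 1 → CMSplit W 2 → ¬ Good W 2 →
      ∀ (N : ℕ) [NeZero N] (K : Type) [Field K] [NumberField K] (Dt : ModularParametrizationData W N),
        W.conductorNorm ℤ = N → IsImaginaryQuadratic K → SatisfiesHeegnerHypothesis N K →
        ∀ (κ : ZpExtension K 2), κ.IsAnticyclotomic → ∀ (γ : Field.absoluteGaloisGroup K) [Fact (κ.IsTopGenerator γ)]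
          (𝔭 : HeightOneSpectrum (𝓞 K)), ((2 : ℕ) : 𝓞 K) ∈ 𝔭.asIdeal → 𝔭.asIdeal.ramificationIdx (𝓞 ℚ) = 1 →
          𝔭.asIdeal.inertiaDeg (𝓞 ℚ) = 1 → ∀ (ι' : PadicAlgCl 2 ≃+* ℂ), SchneiderFree.BranchInducesPrime 2 ι' 𝔭 →
          ∃ (ΩK : ℂ) (Ωp : ℂ_[2]) (Q : PowerSeries (PadicComplexInt 2)),
            ΩK ≠ 0 ∧ Ωp ≠ 0 ∧ R1.IsBDPLFunctionInt 2 ι' 𝔭 κ γ Dt.f ΩK Ωp Q)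
    (hT : ∀ (W : WeierstrassCurve ℚ) [W.IsElliptic] [W.IsGloballyMinimal],
      W.HasCM → W.analyticRank = 1 → CMSplit W 2 → ¬ Good W 2 →
      ∀ (N : ℕ) [NeZero N] (K : Type) [Field K] [NumberField K],
        W.conductorNorm ℤ = N → IsImaginaryQuadratic K → SatisfiesHeegnerHypothesis N K →
        ∀ (κ : ZpExtension K 2), κ.IsAnticyclotomic → ∀ (γ : Field.absoluteGaloisGroup K) [Fact (κ.IsTopGenerator γ)]
          (𝔭 : HeightOneSpectrum (𝓞 K)), ((2 : ℕ) : 𝓞 K) ∈ 𝔭.asIdeal → 𝔭.asIdeal.ramificationIdx (𝓞 ℚ) = 1 →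
          𝔭.asIdeal.inertiaDeg (𝓞 ℚ) = 1 → ∀ (𝔭' : HeightOneSpectrum (𝓞 K)), ((2 : ℕ) : 𝓞 K) ∈ 𝔭'.asIdeal → 𝔭' ≠ 𝔭 →
          Module.IsTorsion (IwasawaAlgebra 2) (XAc (W.baseChange K) 2 κ 𝔭' ∅ γ))
    (h2 : ∀ (W : WeierstrassCurve ℚ) [W.IsElliptic] [W.IsGloballyMinimal],
      W.HasCM → W.analyticRank = 1 → CMSplit W 2 → ¬ Good W 2 →
      ∀ (N : ℕ) [NeZero N] (K : Type) [Field K] [NumberField K] (Dt : ModularParametrizationData W N),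
        W.conductorNorm ℤ = N → IsImaginaryQuadratic K → SatisfiesHeegnerHypothesis N K →
        ∀ (κ : ZpExtension K 2), κ.IsAnticyclotomic → ∀ (γ : Field.absoluteGaloisGroup K) [Fact (κ.IsTopGenerator γ)]
          (𝔭 : HeightOneSpectrum (𝓞 K)), ((2 : ℕ) : 𝓞 K) ∈ 𝔭.asIdeal → 𝔭.asIdeal.ramificationIdx (𝓞 ℚ) = 1 →
          𝔭.asIdeal.inertiaDeg (𝓞 ℚ) = 1 → ∀ (𝔭' : HeightOneSpectrum (𝓞 K)), ((2 : ℕ) : 𝓞 K) ∈ 𝔭'.asIdeal → 𝔭' ≠ 𝔭 →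
          ∀ (ι' : PadicAlgCl 2 ≃+* ℂ), SchneiderFree.BranchInducesPrime 2 ι' 𝔭 →
          ∀ (ΩK : ℂ) (Ωp : ℂ_[2]) (Q : PowerSeries (PadicComplexInt 2)), ΩK ≠ 0 → Ωp ≠ 0 →
            R1.IsBDPLFunctionInt 2 ι' 𝔭 κ γ Dt.f ΩK Ωp Q →
            Module.IsTorsion (IwasawaAlgebra 2) (XAc (W.baseChange K) 2 κ 𝔭' ∅ γ) →
            (XAc.charIdeal (W.baseChange K) 2 κ 𝔭' ∅ γ).map (PowerSeries.map (R1.toCpInt 2)) ≤ Ideal.span {Q})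
    (h3 : ∀ (W : WeierstrassCurve ℚ) [W.IsElliptic] [W.IsGloballyMinimal],
      W.HasCM → W.analyticRank = 1 → CMSplit W 2 → ¬ Good W 2 →
      ∀ (N : ℕ) [NeZero N] (K : Type) [Field K] [NumberField K] (Dt : ModularParametrizationData W N),
        W.conductorNorm ℤ = N → IsImaginaryQuadratic K → SatisfiesHeegnerHypothesis N K →
        ∀ (κ : ZpExtension K 2), κ.IsAnticyclotomic → ∀ (γ : Field.absoluteGaloisGroup K) [Fact (κ.IsTopGenerator γ)]
          (𝔭 : HeightOneSpectrum (𝓞 K)), ((2 : ℕ) : 𝓞 K) ∈ 𝔭.asIdeal → 𝔭.asIdeal.ramificationIdx (𝓞 ℚ) = 1 →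
          𝔭.asIdeal.inertiaDeg (𝓞 ℚ) = 1 → ∀ (𝔭' : HeightOneSpectrum (𝓞 K)), ((2 : ℕ) : 𝓞 K) ∈ 𝔭'.asIdeal → 𝔭' ≠ 𝔭 →
          ∀ (ι' : PadicAlgCl 2 ≃+* ℂ), SchneiderFree.BranchInducesPrime 2 ι' 𝔭 →
          ∀ (ΩK : ℂ) (Ωp : ℂ_[2]) (Q : PowerSeries (PadicComplexInt 2)), ΩK ≠ 0 → Ωp ≠ 0 →
            R1.IsBDPLFunctionInt 2 ι' 𝔭 κ γ Dt.f ΩK Ωp Q →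
            Module.IsTorsion (IwasawaAlgebra 2) (XAc (W.baseChange K) 2 κ 𝔭' ∅ γ) →
            (XAc.charIdeal (W.baseChange K) 2 κ 𝔭' ∅ γ).map (PowerSeries.map (R1.toCpInt 2)) ≤ Ideal.span {Q} →
            Ideal.span {Q} ≤ (XAc.charIdeal (W.baseChange K) 2 κ 𝔭' ∅ γ).map (PowerSeries.map (R1.toCpInt 2)))
    (h4 : (ToricPublishedInputs ∧
      LiuZhangZhang2018.thm151_thm153_modularCurve_heegnerVector_additive ∧
      bsdTriple_of_hasCM_of_L_one_ne_zero ∧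
      (∀ (K : Type) [Field K] [NumberField K], poitouTate_selmerStructure_duality K) ∧
      (∀ (K : Type) [Field K] [NumberField K], poitouTate_sha_tateDual K) ∧
      (∀ (K : Type) [Field K] [NumberField K] (v : HeightOneSpectrum (𝓞 K)),
        localEulerPoincareCharacteristic (v.adicCompletion K)) ∧
      fieldCdLE_two_of_numberField ∧
      (∀ (K : Type) [Field K] [NumberField K] (p : ℕ) [Fact p.Prime],
        ZpExtension.decomp_not_le_kerSubgroup_of_isAnticyclotomic K p)) →
    ∀ (W : WeierstrassCurve ℚ) [W.IsElliptic] [W.IsGloballyMinimal],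
      W.HasCM → W.analyticRank = 1 → CMSplit W 2 → ¬ Good W 2 →
      (∀ (N : ℕ) [NeZero N] (K : Type) [Field K] [NumberField K] (Dt : ModularParametrizationData W N),
        W.conductorNorm ℤ = N → IsImaginaryQuadratic K → SatisfiesHeegnerHypothesis N K →
        ∀ (κ : ZpExtension K 2), κ.IsAnticyclotomic → ∀ (γ : Field.absoluteGaloisGroup K) [Fact (κ.IsTopGenerator γ)]
          (𝔭 : HeightOneSpectrum (𝓞 K)), ((2 : ℕ) : 𝓞 K) ∈ 𝔭.asIdeal → 𝔭.asIdeal.ramificationIdx (𝓞 ℚ) = 1 →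
          𝔭.asIdeal.inertiaDeg (𝓞 ℚ) = 1 → ∀ (ι' : PadicAlgCl 2 ≃+* ℂ), SchneiderFree.BranchInducesPrime 2 ι' 𝔭 →
          ∃ (ΩK : ℂ) (Ωp : ℂ_[2]) (Q : PowerSeries (PadicComplexInt 2)),
            ΩK ≠ 0 ∧ Ωp ≠ 0 ∧ R1.IsBDPLFunctionInt 2 ι' 𝔭 κ γ Dt.f ΩK Ωp Q) →
      (∀ (N : ℕ) [NeZero N] (K : Type) [Field K] [NumberField K],
        W.conductorNorm ℤ = N → IsImaginaryQuadratic K → SatisfiesHeegnerHypothesis N K →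
        ∀ (κ : ZpExtension K 2), κ.IsAnticyclotomic → ∀ (γ : Field.absoluteGaloisGroup K) [Fact (κ.IsTopGenerator γ)]
          (𝔭 : HeightOneSpectrum (𝓞 K)), ((2 : ℕ) : 𝓞 K) ∈ 𝔭.asIdeal → 𝔭.asIdeal.ramificationIdx (𝓞 ℚ) = 1 →
          𝔭.asIdeal.inertiaDeg (𝓞 ℚ) = 1 → ∀ (𝔭' : HeightOneSpectrum (𝓞 K)), ((2 : ℕ) : 𝓞 K) ∈ 𝔭'.asIdeal → 𝔭' ≠ 𝔭 →
          Module.IsTorsion (IwasawaAlgebra 2) (XAc (W.baseChange K) 2 κ 𝔭' ∅ γ)) →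
      (∀ (N : ℕ) [NeZero N] (K : Type) [Field K] [NumberField K] (Dt : ModularParametrizationData W N),
        W.conductorNorm ℤ = N → IsImaginaryQuadratic K → SatisfiesHeegnerHypothesis N K →
        ∀ (κ : ZpExtension K 2), κ.IsAnticyclotomic → ∀ (γ : Field.absoluteGaloisGroup K) [Fact (κ.IsTopGenerator γ)]
          (𝔭 : HeightOneSpectrum (𝓞 K)), ((2 : ℕ) : 𝓞 K) ∈ 𝔭.asIdeal → 𝔭.asIdeal.ramificationIdx (𝓞 ℚ) = 1 →
          𝔭.asIdeal.inertiaDeg (𝓞 ℚ) = 1 → ∀ (𝔭' : HeightOneSpectrum (𝓞 K)), ((2 : ℕ) : 𝓞 K) ∈ 𝔭'.asIdeal → 𝔭' ≠ 𝔭 →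
          ∀ (ι' : PadicAlgCl 2 ≃+* ℂ), SchneiderFree.BranchInducesPrime 2 ι' 𝔭 →
          ∀ (ΩK : ℂ) (Ωp : ℂ_[2]) (Q : PowerSeries (PadicComplexInt 2)), ΩK ≠ 0 → Ωp ≠ 0 →
            R1.IsBDPLFunctionInt 2 ι' 𝔭 κ γ Dt.f ΩK Ωp Q →
            (XAc.charIdeal (W.baseChange K) 2 κ 𝔭' ∅ γ).map (PowerSeries.map (R1.toCpInt 2)) = Ideal.span {Q}) →
      (∀ (N : ℕ) [NeZero N] (K : Type) [Field K] [NumberField K]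
        (Wd : WeierstrassCurve ℚ) [Wd.IsElliptic] [Wd.IsGloballyMinimal],
        W.conductorNorm ℤ = N → IsImaginaryQuadratic K → SatisfiesHeegnerHypothesis N K →
        (∃ C : VariableChange ℚ, C • W.quadraticTwist (NumberField.discr K : ℚ) = Wd) →
        (W.quadraticTwist (NumberField.discr K : ℚ)).entireLFunction 1 ≠ 0 → BSDp Wd 2) →
      BSDp W 2) :
    Summit.BirchSwinnertonDyer.BirchSwinnertonDyer.Theses.PrintCf2.SplitBadTwoRankOneOfFacts := by
  intro hF W _ _ hCM hr hsplit hng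
  obtain ⟨_hGZK, hmod, _hCas, hBF, _hKL⟩ := hF
  refine h4 h0 W hCM hr hsplit hng (h1 h0 W hCM hr hsplit hng) (hT W hCM hr hsplit hng) ?_
    (rankZeroTwistBSDp_two_of_hasCM_of_print hBF hmod W hCM)
  intro N _ K _ _ Dt hN hK hHe κ hκ γ _ 𝔭 h𝔭 he hf 𝔭' h𝔭' hne ι' hind ΩK Ωp Q hΩK hΩp hQ
  have htors := hT W hCM hr hsplit hng N K hN hK hHe κ hκ γ 𝔭 h𝔭 he hf 𝔭' h𝔭' hne
  have hle := h2 W hCM hr hsplit hng N K Dt hN hK hHe κ hκ γ 𝔭 h𝔭 he hf 𝔭' h𝔭' hne ι' hind ΩK Ωp Q hΩK hΩp hQ htors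
  exact le_antisymm hle
    (h3 W hCM hr hsplit hng N K Dt hN hK hHe κ hκ γ 𝔭 h𝔭 he hf 𝔭' h𝔭' hne ι' hind ΩK Ωp Q hΩK hΩp hQ htors hle)


/-- **The K7t `…OfFactsPlus` twin of line `eisenstein_two_bdp_line`, proved**: 𝔅_split ∧ «PRINTS(2)» ∧ the five research / print-gap
statements (frame, torsion, inclusion, upgrade, descent — VERBATIM the registered stubs of skeleton d31d09cefdf06587) ⟹ the class
statement of `SplitBadTwoRankOneOfFacts`. A planner booking this text as an aside on route PrintCf2 closes it by name with this theorem.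
CONDITIONAL; BSD is not proved by any of this. [cite: BurungaleFlach2024, Cor. 2] -/
theorem splitBadEisensteinTwoBdpOfFactsPlus_of_print :
    ((rank_eq_analyticRank_of_analyticRank_le_one ∧ hasEntireLFunction_rat ∧ bsdRHS_eq_of_isIsogenous ∧
      bsdTriple_of_hasCM_of_L_one_ne_zero ∧ KrizLi2019.thm112_bsdTwo_twist) ∧
    ((ToricPublishedInputs ∧
      LiuZhangZhang2018.thm151_thm153_modularCurve_heegnerVector_additive ∧
      bsdTriple_of_hasCM_of_L_one_ne_zero ∧
      (∀ (K : Type) [Field K] [NumberField K], poitouTate_selmerStructure_duality K) ∧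
      (∀ (K : Type) [Field K] [NumberField K], poitouTate_sha_tateDual K) ∧
      (∀ (K : Type) [Field K] [NumberField K] (v : HeightOneSpectrum (𝓞 K)),
        localEulerPoincareCharacteristic (v.adicCompletion K)) ∧
      fieldCdLE_two_of_numberField ∧
      (∀ (K : Type) [Field K] [NumberField K] (p : ℕ) [Fact p.Prime],
        ZpExtension.decomp_not_le_kerSubgroup_of_isAnticyclotomic K p))) ∧
    ((ToricPublishedInputs ∧
      LiuZhangZhang2018.thm151_thm153_modularCurve_heegnerVector_additive ∧
      bsdTriple_of_hasCM_of_L_one_ne_zero ∧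
      (∀ (K : Type) [Field K] [NumberField K], poitouTate_selmerStructure_duality K) ∧
      (∀ (K : Type) [Field K] [NumberField K], poitouTate_sha_tateDual K) ∧
      (∀ (K : Type) [Field K] [NumberField K] (v : HeightOneSpectrum (𝓞 K)),
        localEulerPoincareCharacteristic (v.adicCompletion K)) ∧
      fieldCdLE_two_of_numberField ∧
      (∀ (K : Type) [Field K] [NumberField K] (p : ℕ) [Fact p.Prime],
        ZpExtension.decomp_not_le_kerSubgroup_of_isAnticyclotomic K p)) →
      ∀ (W : WeierstrassCurve ℚ) [W.IsElliptic] [W.IsGloballyMinimal],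
      W.HasCM → W.analyticRank = 1 → CMSplit W 2 → ¬ Good W 2 →
      ∀ (N : ℕ) [NeZero N] (K : Type) [Field K] [NumberField K] (Dt : ModularParametrizationData W N),
        W.conductorNorm ℤ = N → IsImaginaryQuadratic K → SatisfiesHeegnerHypothesis N K →
        ∀ (κ : ZpExtension K 2), κ.IsAnticyclotomic → ∀ (γ : Field.absoluteGaloisGroup K) [Fact (κ.IsTopGenerator γ)]
          (𝔭 : HeightOneSpectrum (𝓞 K)), ((2 : ℕ) : 𝓞 K) ∈ 𝔭.asIdeal → 𝔭.asIdeal.ramificationIdx (𝓞 ℚ) = 1 →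
          𝔭.asIdeal.inertiaDeg (𝓞 ℚ) = 1 → ∀ (ι' : PadicAlgCl 2 ≃+* ℂ), SchneiderFree.BranchInducesPrime 2 ι' 𝔭 →
          ∃ (ΩK : ℂ) (Ωp : ℂ_[2]) (Q : PowerSeries (PadicComplexInt 2)),
            ΩK ≠ 0 ∧ Ωp ≠ 0 ∧ R1.IsBDPLFunctionInt 2 ι' 𝔭 κ γ Dt.f ΩK Ωp Q) ∧
    (∀ (W : WeierstrassCurve ℚ) [W.IsElliptic] [W.IsGloballyMinimal],
      W.HasCM → W.analyticRank = 1 → CMSplit W 2 → ¬ Good W 2 →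
      ∀ (N : ℕ) [NeZero N] (K : Type) [Field K] [NumberField K],
        W.conductorNorm ℤ = N → IsImaginaryQuadratic K → SatisfiesHeegnerHypothesis N K →
        ∀ (κ : ZpExtension K 2), κ.IsAnticyclotomic → ∀ (γ : Field.absoluteGaloisGroup K) [Fact (κ.IsTopGenerator γ)]
          (𝔭 : HeightOneSpectrum (𝓞 K)), ((2 : ℕ) : 𝓞 K) ∈ 𝔭.asIdeal → 𝔭.asIdeal.ramificationIdx (𝓞 ℚ) = 1 →
          𝔭.asIdeal.inertiaDeg (𝓞 ℚ) = 1 → ∀ (𝔭' : HeightOneSpectrum (𝓞 K)), ((2 : ℕ) : 𝓞 K) ∈ 𝔭'.asIdeal → 𝔭' ≠ 𝔭 →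
          Module.IsTorsion (IwasawaAlgebra 2) (XAc (W.baseChange K) 2 κ 𝔭' ∅ γ)) ∧
    (∀ (W : WeierstrassCurve ℚ) [W.IsElliptic] [W.IsGloballyMinimal],
      W.HasCM → W.analyticRank = 1 → CMSplit W 2 → ¬ Good W 2 →
      ∀ (N : ℕ) [NeZero N] (K : Type) [Field K] [NumberField K] (Dt : ModularParametrizationData W N),
        W.conductorNorm ℤ = N → IsImaginaryQuadratic K → SatisfiesHeegnerHypothesis N K →
        ∀ (κ : ZpExtension K 2), κ.IsAnticyclotomic → ∀ (γ : Field.absoluteGaloisGroup K) [Fact (κ.IsTopGenerator γ)]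
          (𝔭 : HeightOneSpectrum (𝓞 K)), ((2 : ℕ) : 𝓞 K) ∈ 𝔭.asIdeal → 𝔭.asIdeal.ramificationIdx (𝓞 ℚ) = 1 →
          𝔭.asIdeal.inertiaDeg (𝓞 ℚ) = 1 → ∀ (𝔭' : HeightOneSpectrum (𝓞 K)), ((2 : ℕ) : 𝓞 K) ∈ 𝔭'.asIdeal → 𝔭' ≠ 𝔭 →
          ∀ (ι' : PadicAlgCl 2 ≃+* ℂ), SchneiderFree.BranchInducesPrime 2 ι' 𝔭 →
          ∀ (ΩK : ℂ) (Ωp : ℂ_[2]) (Q : PowerSeries (PadicComplexInt 2)), ΩK ≠ 0 → Ωp ≠ 0 →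
            R1.IsBDPLFunctionInt 2 ι' 𝔭 κ γ Dt.f ΩK Ωp Q →
            Module.IsTorsion (IwasawaAlgebra 2) (XAc (W.baseChange K) 2 κ 𝔭' ∅ γ) →
            (XAc.charIdeal (W.baseChange K) 2 κ 𝔭' ∅ γ).map (PowerSeries.map (R1.toCpInt 2)) ≤ Ideal.span {Q}) ∧
    (∀ (W : WeierstrassCurve ℚ) [W.IsElliptic] [W.IsGloballyMinimal],
      W.HasCM → W.analyticRank = 1 → CMSplit W 2 → ¬ Good W 2 →
      ∀ (N : ℕ) [NeZero N] (K : Type) [Field K] [NumberField K] (Dt : ModularParametrizationData W N),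
        W.conductorNorm ℤ = N → IsImaginaryQuadratic K → SatisfiesHeegnerHypothesis N K →
        ∀ (κ : ZpExtension K 2), κ.IsAnticyclotomic → ∀ (γ : Field.absoluteGaloisGroup K) [Fact (κ.IsTopGenerator γ)]
          (𝔭 : HeightOneSpectrum (𝓞 K)), ((2 : ℕ) : 𝓞 K) ∈ 𝔭.asIdeal → 𝔭.asIdeal.ramificationIdx (𝓞 ℚ) = 1 →
          𝔭.asIdeal.inertiaDeg (𝓞 ℚ) = 1 → ∀ (𝔭' : HeightOneSpectrum (𝓞 K)), ((2 : ℕ) : 𝓞 K) ∈ 𝔭'.asIdeal → 𝔭' ≠ 𝔭 →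
          ∀ (ι' : PadicAlgCl 2 ≃+* ℂ), SchneiderFree.BranchInducesPrime 2 ι' 𝔭 →
          ∀ (ΩK : ℂ) (Ωp : ℂ_[2]) (Q : PowerSeries (PadicComplexInt 2)), ΩK ≠ 0 → Ωp ≠ 0 →
            R1.IsBDPLFunctionInt 2 ι' 𝔭 κ γ Dt.f ΩK Ωp Q →
            Module.IsTorsion (IwasawaAlgebra 2) (XAc (W.baseChange K) 2 κ 𝔭' ∅ γ) →
            (XAc.charIdeal (W.baseChange K) 2 κ 𝔭' ∅ γ).map (PowerSeries.map (R1.toCpInt 2)) ≤ Ideal.span {Q} →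
            Ideal.span {Q} ≤ (XAc.charIdeal (W.baseChange K) 2 κ 𝔭' ∅ γ).map (PowerSeries.map (R1.toCpInt 2))) ∧
    ((ToricPublishedInputs ∧
      LiuZhangZhang2018.thm151_thm153_modularCurve_heegnerVector_additive ∧
      bsdTriple_of_hasCM_of_L_one_ne_zero ∧
      (∀ (K : Type) [Field K] [NumberField K], poitouTate_selmerStructure_duality K) ∧
      (∀ (K : Type) [Field K] [NumberField K], poitouTate_sha_tateDual K) ∧
      (∀ (K : Type) [Field K] [NumberField K] (v : HeightOneSpectrum (𝓞 K)),
        localEulerPoincareCharacteristic (v.adicCompletion K)) ∧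
      fieldCdLE_two_of_numberField ∧
      (∀ (K : Type) [Field K] [NumberField K] (p : ℕ) [Fact p.Prime],
        ZpExtension.decomp_not_le_kerSubgroup_of_isAnticyclotomic K p)) →
    ∀ (W : WeierstrassCurve ℚ) [W.IsElliptic] [W.IsGloballyMinimal],
      W.HasCM → W.analyticRank = 1 → CMSplit W 2 → ¬ Good W 2 →
      (∀ (N : ℕ) [NeZero N] (K : Type) [Field K] [NumberField K] (Dt : ModularParametrizationData W N),
        W.conductorNorm ℤ = N → IsImaginaryQuadratic K → SatisfiesHeegnerHypothesis N K →
        ∀ (κ : ZpExtension K 2), κ.IsAnticyclotomic → ∀ (γ : Field.absoluteGaloisGroup K) [Fact (κ.IsTopGenerator γ)]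
          (𝔭 : HeightOneSpectrum (𝓞 K)), ((2 : ℕ) : 𝓞 K) ∈ 𝔭.asIdeal → 𝔭.asIdeal.ramificationIdx (𝓞 ℚ) = 1 →
          𝔭.asIdeal.inertiaDeg (𝓞 ℚ) = 1 → ∀ (ι' : PadicAlgCl 2 ≃+* ℂ), SchneiderFree.BranchInducesPrime 2 ι' 𝔭 →
          ∃ (ΩK : ℂ) (Ωp : ℂ_[2]) (Q : PowerSeries (PadicComplexInt 2)),
            ΩK ≠ 0 ∧ Ωp ≠ 0 ∧ R1.IsBDPLFunctionInt 2 ι' 𝔭 κ γ Dt.f ΩK Ωp Q) →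
      (∀ (N : ℕ) [NeZero N] (K : Type) [Field K] [NumberField K],
        W.conductorNorm ℤ = N → IsImaginaryQuadratic K → SatisfiesHeegnerHypothesis N K →
        ∀ (κ : ZpExtension K 2), κ.IsAnticyclotomic → ∀ (γ : Field.absoluteGaloisGroup K) [Fact (κ.IsTopGenerator γ)]
          (𝔭 : HeightOneSpectrum (𝓞 K)), ((2 : ℕ) : 𝓞 K) ∈ 𝔭.asIdeal → 𝔭.asIdeal.ramificationIdx (𝓞 ℚ) = 1 →
          𝔭.asIdeal.inertiaDeg (𝓞 ℚ) = 1 → ∀ (𝔭' : HeightOneSpectrum (𝓞 K)), ((2 : ℕ) : 𝓞 K) ∈ 𝔭'.asIdeal → 𝔭' ≠ 𝔭 →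
          Module.IsTorsion (IwasawaAlgebra 2) (XAc (W.baseChange K) 2 κ 𝔭' ∅ γ)) →
      (∀ (N : ℕ) [NeZero N] (K : Type) [Field K] [NumberField K] (Dt : ModularParametrizationData W N),
        W.conductorNorm ℤ = N → IsImaginaryQuadratic K → SatisfiesHeegnerHypothesis N K →
        ∀ (κ : ZpExtension K 2), κ.IsAnticyclotomic → ∀ (γ : Field.absoluteGaloisGroup K) [Fact (κ.IsTopGenerator γ)]
          (𝔭 : HeightOneSpectrum (𝓞 K)), ((2 : ℕ) : 𝓞 K) ∈ 𝔭.asIdeal → 𝔭.asIdeal.ramificationIdx (𝓞 ℚ) = 1 →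
          𝔭.asIdeal.inertiaDeg (𝓞 ℚ) = 1 → ∀ (𝔭' : HeightOneSpectrum (𝓞 K)), ((2 : ℕ) : 𝓞 K) ∈ 𝔭'.asIdeal → 𝔭' ≠ 𝔭 →
          ∀ (ι' : PadicAlgCl 2 ≃+* ℂ), SchneiderFree.BranchInducesPrime 2 ι' 𝔭 →
          ∀ (ΩK : ℂ) (Ωp : ℂ_[2]) (Q : PowerSeries (PadicComplexInt 2)), ΩK ≠ 0 → Ωp ≠ 0 →
            R1.IsBDPLFunctionInt 2 ι' 𝔭 κ γ Dt.f ΩK Ωp Q →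
            (XAc.charIdeal (W.baseChange K) 2 κ 𝔭' ∅ γ).map (PowerSeries.map (R1.toCpInt 2)) = Ideal.span {Q}) →
      (∀ (N : ℕ) [NeZero N] (K : Type) [Field K] [NumberField K]
        (Wd : WeierstrassCurve ℚ) [Wd.IsElliptic] [Wd.IsGloballyMinimal],
        W.conductorNorm ℤ = N → IsImaginaryQuadratic K → SatisfiesHeegnerHypothesis N K →
        (∃ C : VariableChange ℚ, C • W.quadraticTwist (NumberField.discr K : ℚ) = Wd) →
        (W.quadraticTwist (NumberField.discr K : ℚ)).entireLFunction 1 ≠ 0 → BSDp Wd 2) →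
      BSDp W 2)) →
    ∀ (W : WeierstrassCurve ℚ) [W.IsElliptic] [W.IsGloballyMinimal], W.HasCM → W.analyticRank = 1 →
      CMSplit W 2 → ¬ Good W 2 → BSDp W 2 :=
  fun ⟨hB, h0, h1, hT, h2, h3, h4⟩ ↦ splitBadTwoRankOneOfFacts_of_eisensteinTwoBdp h0 h1 hT h2 h3 h4 hB

end Summit.BirchSwinnertonDyer.BirchSwinnertonDyer.Theorems.PrintCf2
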